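import Literature.Analysis.FluidPDE.LocalBiotSavart
import Literature.Analysis.FluidPDE.LocalSobolevBall
import HarnessLib

/-!
# Tao (2011/2013), proof of Thm. 10.1: the estimate of the nonlinear term on a single Whitney ball

Analysis/FluidPDE support file for the discharge of the nonlinear estimate `Y₆` of Tao 2011, §10
(arXiv:1108.1165, proof of Thm. 10.1, p. 32). After the pointwise estimate for `∇u` on a Whitney
ball `Bᵢ` (the local Biot–Savart law, `FluidPDE/LocalBiotSavart`: `|∇u| ≤ Fᵢ + Gᵢ` on `Bᵢ` with
`‖Fᵢ‖_{L²} ≲ ‖ω‖_{L²(3Bᵢ)}`), Tao bounds the contribution of the ball to `Y₆ = ∫ O(ωω∇u)η` by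
`∫_{Bᵢ}|ω|²|∇u| ≤ ∫_{Bᵢ}|ω|²Fᵢ + Gᵢ∫_{Bᵢ}|ω|²` and, for the first term, "From Hölder's inequality
we thus have `Y₆,₁ ≲ c^{-0.1}δ² Σᵢ rᵢ^{3/2} ‖ω‖²_{L⁶(Bᵢ)} ‖ω‖_{L²(2Bᵢ)}`" followed by the local Sobolev
inequality "`‖ω‖_{L⁶(Bᵢ)} ≲ ‖∇ω‖_{L²(3Bᵢ)} + rᵢ⁻¹‖ω‖_{L²(3Bᵢ)}`" (`FluidPDE/LocalSobolevBall`). This file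
proves the resulting **single-ball estimate**, independently of how the balls are organised
afterwards (discrete or continuous Whitney families):

* `lintegral_sq_mul_le_rpow` — the Hölder step on a set `B` of finite measure:
  `∫_B ω²F ≤ (∫_B ω⁶)^{1/3} μ(B)^{1/6} (∫_B F²)^{1/2}` (exponents `(3, 3/2)` then `(4/3, 4)`);
* `tao2011_Y6_ball_estimate` — there is an absolute constant `K` such that for every smooth
  divergence-free `u` on `ℝ³`, `ω = curl u`, every ball `B = B(c, r)`:
  `∫_B |ω|²‖Du‖ ≤ K (‖Dω‖_{L²(B̄(c,2r))} + r⁻¹‖ω‖_{L²(B̄(c,2r))})² r^{1/2} ‖ω‖_{L²(B(c,3r))} + G ∫_B |ω|²`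
  with `G = 3C₂ r^{-5/2}‖u‖_{L²(ℝ³)}` (if `u ∈ L²`) and with `G = 3C₁ r⁻¹ s` (if `|u| ≤ s`) — Tao's
  `rᵢ^{3/2}‖ω‖²_{L⁶(Bᵢ)}‖ω‖_{L²(2Bᵢ)}` after Sobolev, and the two forms of `Y₆,₂`.

## References

* T. Tao, *Localisation and compactness properties of the Navier–Stokes global regularity
  problem*, Anal. PDE 6 (2013) 25–107 = arXiv:1108.1165 (`Tao2011`), §10, proof of Thm. 10.1,
  p. 32 (the terms `Y₆,₁`, `Y₆,₂`, "From Hölder's inequality …", "from the Sobolev inequality …").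
-/

noncomputable section

open MeasureTheory Set Filter Topology Function Metric InnerProductSpace
open scoped ENNReal NNReal RealInnerProductSpace ContDiff

namespace Literature.Analysis.FluidPDE

/-- Local notation for physical space `ℝ³ = EuclideanSpace ℝ (Fin 3)`. -/
local notation "ℝ³" => EuclideanSpace ℝ (Fin 3)

/-! ### The Hölder step -/

section Holder

variable {α : Type*} [MeasurableSpace α] {μ : Measure α}

/-- **Hölder with exponents `(3, 3/2)` and `(4/3, 4)`**: for `ω, F ≥ 0` measurable,
`∫ ω² F ≤ (∫ ω⁶)^{1/3} μ(univ)^{1/6} (∫ F²)^{1/2}` (Tao: "From Hölder's inequality we thus have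
`∫_{Bᵢ}|ω|²Fᵢ ≲ ‖ω‖²_{L⁶(Bᵢ)} |Bᵢ|^{1/6} ‖Fᵢ‖_{L²}`"). Apply to a restricted measure for a ball.
[cite: Tao2011, §10, proof of Thm. 10.1 (p. 32, Hölder step for Y₆,₁)] -/
theorem lintegral_sq_mul_le_rpow {w F : α → ℝ≥0∞} (hw : AEMeasurable w μ) (hF : AEMeasurable F μ) :
    ∫⁻ x, w x ^ 2 * F x ∂μ ≤
      (∫⁻ x, w x ^ (6 : ℝ) ∂μ) ^ (1 / 3 : ℝ) * μ univ ^ (1 / 6 : ℝ) *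
        (∫⁻ x, F x ^ (2 : ℝ) ∂μ) ^ (1 / 2 : ℝ) := by
  have h3 : (3 : ℝ).HolderConjugate (3 / 2) := by rw [Real.holderConjugate_iff]; norm_num
  have h43 : (4 / 3 : ℝ).HolderConjugate 4 := by rw [Real.holderConjugate_iff]; norm_num
  -- first Hölder
  have step1 := ENNReal.lintegral_mul_le_Lp_mul_Lq μ h3 (hw.pow_const 2) hF
  have e1 : ∀ x, (w x ^ 2) ^ (3 : ℝ) = w x ^ (6 : ℝ) := fun x => by
    rw [← ENNReal.rpow_two, ← ENNReal.rpow_mul]; norm_num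
  simp only [Pi.mul_apply, e1] at step1
  -- second Hölder for `∫ F^{3/2} · 1`
  have step2 := ENNReal.lintegral_mul_le_Lp_mul_Lq μ h43 (hF.pow_const (3 / 2 : ℝ)) aemeasurable_const
    (g := fun _ => 1)
  have e2 : ∀ x, (F x ^ (3 / 2 : ℝ)) ^ (4 / 3 : ℝ) = F x ^ (2 : ℝ) := fun x => by
    rw [← ENNReal.rpow_mul]; norm_num
  simp only [Pi.mul_apply, mul_one, e2, ENNReal.one_rpow, lintegral_const, one_mul] at step2
  -- combine
  calc ∫⁻ x, w x ^ 2 * F x ∂μ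
      ≤ (∫⁻ x, w x ^ (6 : ℝ) ∂μ) ^ (1 / (3 : ℝ)) * (∫⁻ x, F x ^ (3 / 2 : ℝ) ∂μ) ^ (1 / (3 / 2 : ℝ)) := step1
    _ ≤ (∫⁻ x, w x ^ (6 : ℝ) ∂μ) ^ (1 / (3 : ℝ)) *
          ((∫⁻ x, F x ^ (2 : ℝ) ∂μ) ^ (1 / (4 / 3 : ℝ)) * μ univ ^ (1 / (4 : ℝ))) ^ (1 / (3 / 2 : ℝ)) := by
        gcongr
    _ = (∫⁻ x, w x ^ (6 : ℝ) ∂μ) ^ (1 / 3 : ℝ) * μ univ ^ (1 / 6 : ℝ) *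
          (∫⁻ x, F x ^ (2 : ℝ) ∂μ) ^ (1 / 2 : ℝ) := by
        rw [ENNReal.mul_rpow_of_nonneg _ _ (by norm_num : (0:ℝ) ≤ 1 / (3 / 2)), ← ENNReal.rpow_mul,
          ← ENNReal.rpow_mul]
        norm_num
        ring

end Holder

/-! ### The single-ball estimate -/

section Ball

variable {u : ℝ³ → ℝ³} {c : ℝ³} {r : ℝ}

/-- `μ(B(c, r))^{1/6} = r^{1/2} μ(B(0,1))^{1/6}` in `ℝ³`. [folklore] -/
theorem volume_ball_rpow_sixth (c : ℝ³) (hr : 0 < r) :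
    volume (ball c r) ^ (1 / 6 : ℝ) =
      ENNReal.ofReal r ^ (1 / 2 : ℝ) * volume (ball (0 : ℝ³) 1) ^ (1 / 6 : ℝ) := by
  rw [Measure.addHaar_ball_of_pos volume c hr, finrank_euclideanSpace_fin,
    ENNReal.mul_rpow_of_nonneg _ _ (by norm_num : (0:ℝ) ≤ 1 / 6), ENNReal.ofReal_pow hr.le,
    ← ENNReal.rpow_natCast, ← ENNReal.rpow_mul]
  norm_num

/-- From a pointwise majorant to the integral bound: if `‖Du‖ ≤ F + G` on `B = B(c, r)` with
`F ≥ 0` continuous, `∫ F² ≤ A`, and `G ≥ 0`, then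
`∫_B |ω|²‖Du‖ ≤ ‖ω‖²_{L⁶(B)} μ(B)^{1/6} A^{1/2} + G ∫_B |ω|²` (`ω` any continuous field).
[cite: Tao2011, §10, proof of Thm. 10.1 (p. 32, `|Y₆| ≤ Y₆,₁ + Y₆,₂`)] -/
theorem lintegral_ball_sq_mul_enorm_fderiv_le {w : ℝ³ → ℝ³} (hw : Continuous w) {F : ℝ³ → ℝ}
    (hFc : Continuous F) (hF0 : ∀ x, 0 ≤ F x) (hFi : Integrable fun x => F x ^ 2) {A G : ℝ}
    (hA : ∫ x, F x ^ 2 ≤ A) (hG : 0 ≤ G)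
    (hDu : ∀ x ∈ ball c r, ‖fderiv ℝ u x‖ ≤ F x + G) :
    ∫⁻ x in ball c r, ‖w x‖ₑ ^ 2 * ‖fderiv ℝ u x‖ₑ ≤
      eLpNorm w 6 (volume.restrict (ball c r)) ^ 2 * volume (ball c r) ^ (1 / 6 : ℝ) *
          ENNReal.ofReal A ^ (1 / 2 : ℝ) +
        ENNReal.ofReal G * ∫⁻ x in ball c r, ‖w x‖ₑ ^ 2 := by
  set μ' : Measure ℝ³ := volume.restrict (ball c r) with hμ'
  -- pointwise: `‖Du‖ₑ ≤ ofReal F + ofReal G` on the ball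
  have hpt : ∀ᵐ x ∂μ', ‖w x‖ₑ ^ 2 * ‖fderiv ℝ u x‖ₑ ≤
      ‖w x‖ₑ ^ 2 * ENNReal.ofReal (F x) + ENNReal.ofReal G * ‖w x‖ₑ ^ 2 := by
    filter_upwards [ae_restrict_mem measurableSet_ball] with x hx
    calc ‖w x‖ₑ ^ 2 * ‖fderiv ℝ u x‖ₑ ≤ ‖w x‖ₑ ^ 2 * (ENNReal.ofReal (F x) + ENNReal.ofReal G) := by
          gcongr
          rw [← ofReal_norm, ← ENNReal.ofReal_add (hF0 x) hG]
          exact ENNReal.ofReal_le_ofReal (hDu x hx)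
      _ = ‖w x‖ₑ ^ 2 * ENNReal.ofReal (F x) + ENNReal.ofReal G * ‖w x‖ₑ ^ 2 := by ring
  have hωm : AEMeasurable (fun x => ‖w x‖ₑ) μ' := hw.enorm.aemeasurable
  have hFm : AEMeasurable (fun x => ENNReal.ofReal (F x)) μ' := hFc.measurable.ennreal_ofReal.aemeasurable
  calc ∫⁻ x in ball c r, ‖w x‖ₑ ^ 2 * ‖fderiv ℝ u x‖ₑ
      ≤ ∫⁻ x in ball c r, (‖w x‖ₑ ^ 2 * ENNReal.ofReal (F x) + ENNReal.ofReal G * ‖w x‖ₑ ^ 2) :=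
        lintegral_mono_ae hpt
    _ = (∫⁻ x in ball c r, ‖w x‖ₑ ^ 2 * ENNReal.ofReal (F x)) +
          ENNReal.ofReal G * ∫⁻ x in ball c r, ‖w x‖ₑ ^ 2 := by
        rw [lintegral_add_right' _ ((hωm.pow_const 2).const_mul _), lintegral_const_mul'' _ (hωm.pow_const 2)]
    _ ≤ (∫⁻ x in ball c r, ‖w x‖ₑ ^ (6 : ℝ)) ^ (1 / 3 : ℝ) * μ' univ ^ (1 / 6 : ℝ) *
          (∫⁻ x in ball c r, ENNReal.ofReal (F x) ^ (2 : ℝ)) ^ (1 / 2 : ℝ) +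
          ENNReal.ofReal G * ∫⁻ x in ball c r, ‖w x‖ₑ ^ 2 := by
        gcongr
        exact lintegral_sq_mul_le_rpow hωm hFm
    _ ≤ (∫⁻ x in ball c r, ‖w x‖ₑ ^ (6 : ℝ)) ^ (1 / 3 : ℝ) * volume (ball c r) ^ (1 / 6 : ℝ) *
          ENNReal.ofReal A ^ (1 / 2 : ℝ) +
          ENNReal.ofReal G * ∫⁻ x in ball c r, ‖w x‖ₑ ^ 2 := by
        gcongr ?_ * ?_ * ?_ + _
        · exact le_rfl
        · rw [hμ', Measure.restrict_apply_univ]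
        · refine ENNReal.rpow_le_rpow ?_ (by norm_num)
          calc ∫⁻ x in ball c r, ENNReal.ofReal (F x) ^ (2 : ℝ)
              ≤ ∫⁻ x, ENNReal.ofReal (F x) ^ (2 : ℝ) := lintegral_mono' Measure.restrict_le_self le_rfl
            _ = ∫⁻ x, ENNReal.ofReal (F x ^ 2) := by
                refine lintegral_congr fun x => ?_
                rw [ENNReal.rpow_two, ← ENNReal.ofReal_pow (hF0 x)]
            _ = ENNReal.ofReal (∫ x, F x ^ 2) := by
                rw [ofReal_integral_eq_lintegral_ofReal hFi (Eventually.of_forall fun x => sq_nonneg _)]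
            _ ≤ ENNReal.ofReal A := ENNReal.ofReal_le_ofReal hA
    _ = eLpNorm w 6 μ' ^ 2 * volume (ball c r) ^ (1 / 6 : ℝ) * ENNReal.ofReal A ^ (1 / 2 : ℝ) +
          ENNReal.ofReal G * ∫⁻ x in ball c r, ‖w x‖ₑ ^ 2 := by
        have hL6 : (∫⁻ x in ball c r, ‖w x‖ₑ ^ (6 : ℝ)) ^ (1 / 3 : ℝ) = eLpNorm w 6 μ' ^ 2 := by
          rw [eLpNorm_eq_lintegral_rpow_enorm_toReal (by norm_num) (by norm_num), ENNReal.toReal_ofNat,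
            ← ENNReal.rpow_two, ← ENNReal.rpow_mul, hμ']
          norm_num
        rw [hL6]

end Ball

/-! ### Assembly with the local Biot–Savart law and the local Sobolev inequality -/

section Assembly

variable {u : ℝ³ → ℝ³} {c : ℝ³} {r : ℝ}

/-- `(eLpNorm ω 2 (B(c,3r)))² = ∫⁻_{B(c,3r)} ‖ω‖ₑ²` and the real integral `∫_{B(c,3r)}‖ω‖²` agree with it
for continuous `ω`. [folklore] -/
theorem ofReal_setIntegral_norm_sq_eq_eLpNorm_sq {w : ℝ³ → ℝ³} (hw : Continuous w) (c : ℝ³) (R : ℝ) :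
    ENNReal.ofReal (∫ y in ball c R, ‖w y‖ ^ 2) = eLpNorm w 2 (volume.restrict (ball c R)) ^ 2 := by
  have hi : IntegrableOn (fun y => ‖w y‖ ^ 2) (ball c R) :=
    ((hw.norm.pow 2).continuousOn.integrableOn_compact (isCompact_closedBall c R)).mono_set
      ball_subset_closedBall
  rw [ofReal_integral_eq_lintegral_ofReal hi (Eventually.of_forall fun y => sq_nonneg _),
    eLpNorm_two_sq_eq_lintegral]
  refine lintegral_congr fun y => ?_
  rw [← ofReal_norm, ENNReal.ofReal_pow (norm_nonneg _)]

/-- **Tao 2011, proof of Thm. 10.1 — the nonlinear term on a single Whitney ball.** There is an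
absolute constant `K` such that for every `u ∈ C^∞(ℝ³; ℝ³)` with `div u = 0`, `ω = curl u`, every
ball `B = B(c, r)`, `r > 0`, writing
`X = ‖Dω‖_{L²(B̄(c,2r))} + r⁻¹‖ω‖_{L²(B̄(c,2r))}` (operator norm of `Dω`):

* if `u ∈ L²(ℝ³)`:
  `∫_B |ω|² ‖Du‖ ≤ K X² r^{1/2} ‖ω‖_{L²(B(c,3r))} + 3C₂ r^{-5/2} ‖u‖_{L²} ∫_B |ω|²`;
* if `|u| ≤ s` everywhere:
  `∫_B |ω|² ‖Du‖ ≤ K X² r^{1/2} ‖ω‖_{L²(B(c,3r))} + 3C₁ r⁻¹ s ∫_B |ω|²`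

(`C₁ = lamGradL1`, `C₂ = lamGradL2`). This is the ball-by-ball content of Tao's bounds
"`Y₆,₁ ≲ c^{-0.1}δ² Σᵢ rᵢ^{3/2}‖ω‖²_{L⁶(Bᵢ)}‖ω‖_{L²(2Bᵢ)}`" with
"`‖ω‖_{L⁶(Bᵢ)} ≲ ‖∇ω‖_{L²(3Bᵢ)} + rᵢ⁻¹‖ω‖_{L²(3Bᵢ)}`", and of the two cases of `Y₆,₂`
(`rᵢ^{-5/2}‖u‖_{L²}` via the energy, `≲ ‖u‖_{L^∞}` on the layer): local Biot–Savart law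
(`local_biotSavart_bound`), Hölder (`lintegral_sq_mul_le_rpow`) and the local Sobolev inequality
(`LocalSobolevBall.eLpNorm_six_ball_le`). [cite: Tao2011, §10, proof of Thm. 10.1 (p. 32, Y₆,₁ and Y₆,₂)] -/
theorem tao2011_Y6_ball_estimate :
    ∃ K : ℝ≥0, ∀ ⦃u : ℝ³ → ℝ³⦄, ContDiff ℝ ∞ u → VectorCalculus.IsDivFree u →
      ∀ (c : ℝ³) ⦃r : ℝ⦄, 0 < r →
      ((Integrable fun y => ‖u y‖ ^ 2) →
        ∫⁻ x in ball c r, ‖curl u x‖ₑ ^ 2 * ‖fderiv ℝ u x‖ₑ ≤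
          K * (eLpNorm (fun x => fderiv ℝ (curl u) x) 2 (volume.restrict (closedBall c (2 * r))) +
              (ENNReal.ofReal r)⁻¹ * eLpNorm (curl u) 2 (volume.restrict (closedBall c (2 * r)))) ^ 2 *
            ENNReal.ofReal r ^ (1 / 2 : ℝ) * eLpNorm (curl u) 2 (volume.restrict (ball c (3 * r))) +
          ENNReal.ofReal (3 * lamGradL2 * Real.sqrt (r⁻¹ ^ 5) * Real.sqrt (∫ y, ‖u y‖ ^ 2)) *
            ∫⁻ x in ball c r, ‖curl u x‖ₑ ^ 2) ∧
      (∀ s : ℝ, (∀ y, ‖u y‖ ≤ s) →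
        ∫⁻ x in ball c r, ‖curl u x‖ₑ ^ 2 * ‖fderiv ℝ u x‖ₑ ≤
          K * (eLpNorm (fun x => fderiv ℝ (curl u) x) 2 (volume.restrict (closedBall c (2 * r))) +
              (ENNReal.ofReal r)⁻¹ * eLpNorm (curl u) 2 (volume.restrict (closedBall c (2 * r)))) ^ 2 *
            ENNReal.ofReal r ^ (1 / 2 : ℝ) * eLpNorm (curl u) 2 (volume.restrict (ball c (3 * r))) +
          ENNReal.ofReal (3 * lamGradL1 * r⁻¹ * s) * ∫⁻ x in ball c r, ‖curl u x‖ₑ ^ 2) := by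
  -- the constants
  obtain ⟨C_LS, hC_LS0, hLS⟩ := LocalSobolevBall.eLpNorm_six_ball_le (E := ℝ³) (F := ℝ³)
    finrank_euclideanSpace_fin
  set K_S : ℝ≥0 := SNormLESNormFDerivOfEqConst ℝ³ (volume : Measure ℝ³) 2 with hK_S
  set Cmax : ℝ≥0 := max 1 C_LS.toNNReal with hCmax
  set V : ℝ≥0∞ := volume (ball (0 : ℝ³) 1) ^ (1 / 6 : ℝ) with hV
  have hVt : V ≠ ⊤ := ENNReal.rpow_ne_top_of_nonneg (by norm_num) measure_ball_lt_top.ne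
  set A₀ : ℝ := 486 * (1 + regLaplacianMass ^ 2) with hA₀
  have hA₀0 : 0 ≤ A₀ := by positivity
  set KA : ℝ≥0 := (Real.sqrt A₀).toNNReal with hKA
  set K : ℝ≥0 := (K_S * Cmax) ^ 2 * V.toNNReal * KA with hK
  refine ⟨K, fun u hu hdiv c r hr => ?_⟩
  -- common part
  have hω : Continuous (curl u) := continuous_curl (hu.of_le (by norm_cast))
  have hω1 : ContDiff ℝ 1 (curl u) := contDiff_curl (n := 1) (hu.of_le (by norm_cast))
  obtain ⟨F, hFc, hF0, hFi, hFA, hL2, hLs⟩ := local_biotSavart_bound hu hdiv c hr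
  set X : ℝ≥0∞ := eLpNorm (fun x => fderiv ℝ (curl u) x) 2 (volume.restrict (closedBall c (2 * r))) +
    (ENNReal.ofReal r)⁻¹ * eLpNorm (curl u) 2 (volume.restrict (closedBall c (2 * r))) with hX
  -- Sobolev: `‖ω‖_{L⁶(B)} ≤ K_S Cmax X`
  have hSob : eLpNorm (curl u) 6 (volume.restrict (ball c r)) ≤ (K_S * Cmax : ℝ≥0) * X := by
    have h := hLS hω1 c hr
    refine h.trans ?_
    rw [ENNReal.coe_mul, mul_assoc]
    gcongr
    -- `eLpNorm Dω + ofReal (C_LS/r) eLpNorm ω ≤ Cmax * X`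
    have h1 : (1 : ℝ≥0∞) ≤ Cmax := by exact_mod_cast le_max_left _ _
    have h2 : ENNReal.ofReal (C_LS / r) ≤ (Cmax : ℝ≥0∞) * (ENNReal.ofReal r)⁻¹ := by
      rw [div_eq_mul_inv, ENNReal.ofReal_mul hC_LS0, ENNReal.ofReal_inv_of_pos hr]
      gcongr
      rw [show ENNReal.ofReal C_LS = (C_LS.toNNReal : ℝ≥0∞) from rfl]
      exact_mod_cast le_max_right _ _
    calc eLpNorm (fderiv ℝ (curl u)) 2 (volume.restrict (closedBall c (2 * r))) +
          ENNReal.ofReal (C_LS / r) * eLpNorm (curl u) 2 (volume.restrict (closedBall c (2 * r)))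
        ≤ Cmax * eLpNorm (fun x => fderiv ℝ (curl u) x) 2 (volume.restrict (closedBall c (2 * r))) +
          (Cmax * (ENNReal.ofReal r)⁻¹) * eLpNorm (curl u) 2 (volume.restrict (closedBall c (2 * r))) := by
          gcongr
          exact le_mul_of_one_le_left (by simp) h1
      _ = Cmax * X := by rw [hX, mul_add, mul_assoc]
  -- the `F`-part: `‖ω‖²_{L⁶} μ(B)^{1/6} (486(1+M²) ∫_{3B}|ω|²)^{1/2} ≤ K X² r^{1/2} ‖ω‖_{L²(3B)}`
  have hFpart : eLpNorm (curl u) 6 (volume.restrict (ball c r)) ^ 2 * volume (ball c r) ^ (1 / 6 : ℝ) *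
      ENNReal.ofReal (A₀ * ∫ y in ball c (3 * r), ‖curl u y‖ ^ 2) ^ (1 / 2 : ℝ) ≤
      K * X ^ 2 * ENNReal.ofReal r ^ (1 / 2 : ℝ) * eLpNorm (curl u) 2 (volume.restrict (ball c (3 * r))) := by
    have hsq : ∀ x : ℝ≥0∞, (x ^ 2) ^ (1 / 2 : ℝ) = x := fun x => by
      rw [← ENNReal.rpow_two, ← ENNReal.rpow_mul]; norm_num
    rw [volume_ball_rpow_sixth c hr, ENNReal.ofReal_mul hA₀0, ofReal_setIntegral_norm_sq_eq_eLpNorm_sq hω,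
      ENNReal.mul_rpow_of_nonneg _ _ (by norm_num : (0:ℝ) ≤ 1 / 2), hsq]
    have hA : ENNReal.ofReal A₀ ^ (1 / 2 : ℝ) = (KA : ℝ≥0∞) := by
      rw [hKA, show ((Real.sqrt A₀).toNNReal : ℝ≥0∞) = ENNReal.ofReal (Real.sqrt A₀) from rfl,
        Real.sqrt_eq_rpow, ENNReal.ofReal_rpow_of_nonneg hA₀0 (by norm_num)]
    have hVeq : volume (ball (0 : ℝ³) 1) ^ (1 / 6 : ℝ) = (V.toNNReal : ℝ≥0∞) := (ENNReal.coe_toNNReal hVt).symm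
    rw [hA, hVeq]
    calc eLpNorm (curl u) 6 (volume.restrict (ball c r)) ^ 2 *
          (ENNReal.ofReal r ^ (1 / 2 : ℝ) * (V.toNNReal : ℝ≥0∞)) *
          ((KA : ℝ≥0∞) * eLpNorm (curl u) 2 (volume.restrict (ball c (3 * r))))
        ≤ ((K_S * Cmax : ℝ≥0) * X) ^ 2 * (ENNReal.ofReal r ^ (1 / 2 : ℝ) * (V.toNNReal : ℝ≥0∞)) *
          ((KA : ℝ≥0∞) * eLpNorm (curl u) 2 (volume.restrict (ball c (3 * r)))) := by
          gcongr
      _ = K * X ^ 2 * ENNReal.ofReal r ^ (1 / 2 : ℝ) * eLpNorm (curl u) 2 (volume.restrict (ball c (3 * r))) := by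
          rw [hK]; push_cast; ring
  refine ⟨fun hL2u => ?_, fun s hs => ?_⟩
  · have hG : 0 ≤ 3 * lamGradL2 * Real.sqrt (r⁻¹ ^ 5) * Real.sqrt (∫ y, ‖u y‖ ^ 2) := by
      have := lamGradL2_nonneg; positivity
    have h := lintegral_ball_sq_mul_enorm_fderiv_le (c := c) (r := r) hω hFc hF0 hFi
      (A := A₀ * ∫ y in ball c (3 * r), ‖curl u y‖ ^ 2) hFA hG (hL2 hL2u)
    exact h.trans (by gcongr)
  · by_cases hs0 : 0 ≤ s
    · have hG : 0 ≤ 3 * lamGradL1 * r⁻¹ * s := by have := lamGradL1_nonneg; positivity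
      have h := lintegral_ball_sq_mul_enorm_fderiv_le (c := c) (r := r) hω hFc hF0 hFi
        (A := A₀ * ∫ y in ball c (3 * r), ‖curl u y‖ ^ 2) hFA hG (hLs s hs)
      exact h.trans (by gcongr)
    · -- `s < 0` is impossible unless the space is empty: `‖u y‖ ≤ s < 0`
      exfalso
      exact hs0 ((norm_nonneg (u c)).trans (hs c))

end Assembly

end Literature.Analysis.FluidPDE

end
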